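import Summits.AnomalousDissipation.AnomalousDissipation.Theses.FrictionOrderLadder

/-!
# Birth skeleton (BC3) — crux `FrictionOrderLadder.NoMeanLeakage` (stmt-AnomalousDissipation-2933)

Route `route-AnomalousDissipation-FrictionOrderLadder` (`closes : CleanRoomInjectionFloor → NoMeanLeakage →
HyperviscousDescent → AnomalousDissipation`), item stmt-AnomalousDissipation-2933, crux rank 3:
NO MEAN LERAY–HOPF LEAKAGE FOR HYPERVISCOSITY-SELECTED SOLUTIONS AT FIXED `ν > 0` — for a smooth steady
divergence-free mean-zero force `f`, smooth divergence-free mean-zero datum `u₀` and a global Leray–Hopf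
solution `u` of `NS_ν(f)` that is a strong `L²((0,T) × T³)` limit (every `T`) of classical solutions of
Lions' clean room `∂ₜu + (u·∇)u + ∇p = νΔu − μ_kΔ²u + f`, `μ_k → 0`, same datum:
`⟨(f,u)⟩ ≤ ν⟨‖∇u‖₂²⟩`, i.e. `longTimeAvgSup (t ↦ ∫⟪f, u(t)⟫) ≤ meanDissipation ν u` (real `limsup` of
Cesàro means; spectral `Torus.eGradNormSq`, `toReal`).
Skeleton registrar planner-skel-stmt-AnomalousDissipation-2933-0, 2026-08-17 (route re-audit bin REPAIRABLE;
`Cruxes/NoMeanLeakage/` had no workfile before this one; no `Disproof.lean` to honour).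

## The line of this skeleton: ABSORBING BALL × TAME DISSIPATION MEANS × SUBLINEAR DEFECT, glued by a PROVED
## Cesàro–`limsup` domination lemma (three registered stubs)

Write the Leray–Hopf energy budget of the selected solution on `[0, T]` as
`E(u₀) + ∫₀ᵀ (f,u) = E(u(T)) + ν∫₀ᵀ ‖∇u‖₂² + Δ(T)`, `Δ(T) ≥ 0` the cumulative ENERGY DEFECT (the Leray–Hopf
energy inequality from `0` is `Δ ≥ 0`; for the hyperviscosity-selected `u`,
`Δ(T) = lim inf_k [ν∫₀ᵀ‖∇u_k‖² + μ_k∫₀ᵀ‖Δu_k‖²] − ν∫₀ᵀ‖∇u‖²`, the viscous + hyperviscous dissipation LOST in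
the limit `μ_k → 0`, because the clean-room solutions satisfy the EXACT balance while injection and slice
energies pass to the strong `L²_{t,x}` limit). Dividing by `T` and taking `limsup`, the crux says exactly:
the defect does not contribute to the MEAN. The seam separates the three things a proof must supply — a
uniform energy bound, an upper bound on the dissipation means, and control of the defect — and the passage to
`limsup` (the only place where the `Real.sInf` junk of `Filter.limsup` matters) is PROVED here once and for
all (`cesaroDomination`, sorry-free).

* `stub_absorbingBall` (ABSORBING BALL at fixed `ν`; known-type, TRUE, size M–L in Lean; VERBATIM the open
  support item `Correlation.AbsorbingBallLHTorus` = stmt-AnomalousDissipation-0447 of route Correlation, so that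
  ONE proof discharges both — dedup by normalised signature). For `ν > 0`, smooth mean-zero steady `f` and ANY
  global Leray–Hopf `u` (any datum, no selection): `∃ C, ∀ t ≥ 0, E(u(t)) ≤ C`. Print: momentum conservation
  (`∫f = 0` ⇒ `ū(t) = ū₀`, constant test fields in `IsWeakNSSolutionForcedOn`), spectral Poincaré
  `‖∇v‖₂² ≥ 4π²‖v − v̄‖₂²` (immediate for `eGradNormSq`), energy inequality from a.e. `s`
  (`IsLerayHopfOn.energy_ineq_ae`) ⇒ integral Gronwall from a.e. base points (FoiasManleyRosaTemam2001 Ch. II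
  (7.9), App. A (A.41)–(A.42); DoeringFoias2002 §2; Temam1979 Ch. III Rem. 3.2). `C ∝ ν⁻²` is allowed — this is
  NOT a ν-uniform ceiling of the refuted kind (GPEnergyCeiling 2979 / EnsembleCeilingBridge 2984 /
  CorrelationEnergyUnboundedNeg 0204 range over families `ν → 0`). Why it might fail: it should not; Lean cost =
  mean propagation from the weak form, the a.e.-`s` Gronwall, `toReal` of the lintegral (finite by
  `memL2Sobolev`).
* `stub_tameDissipationMeans` (the DOERING–FOIAS UPPER BOUND at fixed `ν`, qualitative form; known-type, TRUE,
  size M in Lean). For `ν > 0`, smooth `f`, a global Leray–Hopf `u` with `E(u(t)) ≤ C` (`t ≥ 0`): the Cesàro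
  means `T⁻¹∫₀ᵀ ν‖∇u‖₂²` (the integrand of `meanDissipation`, Bochner in time) are bounded above at `+∞`.
  Print: energy inequality from `0` at `t = T` (`IsLerayHopfOn.energy_ineq_zero`), `E(u(T)) ≥ 0`,
  `|(f,u(t))| ≤ ‖f‖₂√(2C)` slice-wise (Cauchy–Schwarz, `memLp`;
  `intervalIntegral.norm_integral_le_of_norm_le_const` needs no integrability) and Bochner
  `∫₀ᵀ toReal G ≤ toReal ∫⁻₀ᵀ G` (finite by `memL2Sobolev`; a junk interval integral is `0`, still bounded):
  `T⁻¹∫₀ᵀ ν‖∇u‖² ≤ E(u₀)/T + ‖f‖₂√(2C)` (DoeringFoias2002 §2 (2.5)–(2.7); FoiasManleyRosaTemam2001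
  (12.38)–(12.39); the plan of support item stmt-AnomalousDissipation-0446). Why it might fail: it should not;
  Lean cost = measurability of `t ↦ eGradNormSq (u t)` (Fourier coefficients of `stLift u`, Fubini) and the
  lintegral/Bochner conversion.
* `stub_selectedDefectSublinear` (THE HEART, XL; "zero time-density of the Leray–Hopf energy defect of
  hyperviscosity-selected solutions"). Under the crux's hypotheses VERBATIM (selection included) there is
  `D : ℝ → ℝ` with `D(T)/T → 0` and, for every `T > 0`,
  `E(u₀) + ∫₀ᵀ(f,u) ≤ E(u(T)) + ∫₀ᵀ ν‖∇u‖₂² + D(T)` — the REVERSE energy inequality up to a sublinear error.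
  A genuine STRENGTHENING of the crux (pointwise-in-`T` sublinear defect versus a comparison of two `limsup`s;
  the crux does not give it back when the dissipation means oscillate), and the physically natural statement:
  at fixed `ν > 0` a selected physical solution may have singular epochs, but they do not drain energy at a
  positive RATE. Mechanisms on offer (each a line for the lead): (a) eventual / locally-uniform Shinbrot–Lions
  integrability of the selected solution, `u ∈ L⁴(T₀, T₀+1; L⁴)` with bounds uniform in `T₀` ⇒ exact balance on
  those windows by the PROVED tree theorem `Literature.Analysis.FluidPDE.lions_energy_equality_Ioc'`
  (Lions 1960 / Shinbrot 1974; RobinsonRodrigoSadowski2016 Thm 4.6 & notes p. 135; also in tree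
  `galdi_energy_equality_holds`, Duchon–Robert `IsLerayHopfOn.exists_dissipationMeasure_univ_le` = the defect
  as a measure, so the stub reads "the Duchon–Robert measure of the selected solution has zero time density");
  (b) μ-UNIFORM `L²_tH²_x` (or `L⁴_tL⁴_x`) bounds on the clean-room family on time sets of density `1 − o(1)` ⇒
  no loss of dissipation there (`ν∫‖∇u_k‖² → ν∫‖∇u‖²` by strong compactness one derivative up); (c) Leray's
  eventual regularity made quantitative for steady forcing at the absorbing-ball level (partial regularity /
  weak-strong uniqueness epochs; Leray1934 §34, CKN1982). Why it might fail: exactly the crux's failure mode — a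
  hyperviscosity-selected Leray–Hopf solution whose energy defects RECUR with positive time density (an energy
  sink of positive rate at fixed `ν`; leakage is real in weaker classes: BuckmasterVicol2019AnnMath,
  CheskidovLuo2022) — plus the extra pointwise strength. Sources: Leray1934, Shinbrot1974, CKN1982,
  DuchonRobert2000, RobinsonRodrigoSadowski2016 §4.3, BeiraoDaVeiga1985 = LemarieRieusset2016 Thm 18.5 (the
  selection), the item's refuter/grounder stamps ("claim ⟺ zero time-density of the LH energy defect").

PROVED glue `cesaroDomination` (Cesàro–`limsup` domination in the tree's long-time-average vocabulary, ~30
lines, no `sorry`): for real `g, h, D`, if `∫₀ᵀ g ≤ ∫₀ᵀ h + D(T)` eventually, `D(T)/T → 0`, and the Cesàro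
means of `h` are eventually `≥ 0` and bounded above, then `longTimeAvgSup g ≤ longTimeAvgSup h` — with NO
hypothesis on the means of `g`: either they are cobounded and `m_g ≤ m_h + D/T < limsup m_h + ε` eventually
(`eventually_lt_of_limsup_lt`, `limsup_le_of_le`), or `limsup m_g` is the `Real.sInf` junk value `0` of a set
unbounded below and `0 ≤ limsup m_h` (`le_limsup_of_frequently_le`). Reusable by every budget-based route.

Composition `NoMeanLeakage_of` (sorry-free honest logic + light real analysis, not a one-line seam): the
absorbing ball (stub 1) gives `C`; stub 2 bounds the dissipation means above; the heart (stub 3) gives `D`;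
the corrected error `D'(T) = D(T) + E(u(T)) − E(u₀)` is sublinear (`D/T → 0`, `0 ≤ E(u(T)) ≤ C` squeezed,
`E(u₀)/T → 0`: `Tendsto.div_atTop`, `squeeze_zero'`) and turns the budget into
`∫₀ᵀ(f,u) ≤ ∫₀ᵀ ν‖∇u‖² + D'(T)` for `T > 0`; the dissipation means are `≥ 0` (`intervalIntegral.integral_nonneg`,
no integrability needed); `cesaroDomination` with `g = (f,u)`, `h = ν‖∇u‖₂²` is then LITERALLY the crux's
inequality (`meanDissipation ν u = longTimeAvgSup (t ↦ ν‖∇u(t)‖₂²)` by `rfl`). The conclusion is the route decl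
`FrictionOrderLadder.NoMeanLeakage` BY NAME.

Relations recorded (not used by the file): (1) the UNIVERSAL form of this crux — every global Leray–Hopf
solution, any datum, no selection — is the open crux `Correlation.NoMeanLeakage` (stmt-AnomalousDissipation-14265,
rank 8 of route Correlation); a proof of 14265 closes this crux by a one-line specialisation, a refutation of
THIS crux refutes 14265. (2) No new route, no new item: this file only registers the skeleton.

## Disproof / negatives honoured

No `Cruxes/NoMeanLeakage/Disproof.lean` exists (`ledger crux ls stmt-AnomalousDissipation-2933`: no workfiles,
2026-08-17) — nothing to cite. Item evidence: two refuter route-review stamps (rc 0; "claim ⟺ zero time-density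
of the LH energy defect for hyperviscosity-selected solutions at FIXED ν; limsup junk excluded by bounded
energies; selection pins `u` a.e.") and one grounder stamp (verdict NEW / OPEN at fixed ν). The skeleton answers
the stamps structurally: "bounded energies" is stubs 1–2 (proved-in-print tameness, isolated so that the heart
carries no bookkeeping), "zero time-density" is stub 3 verbatim, and the `limsup`-junk analysis is the PROVED
lemma `cesaroDomination`. Negatives (`ledger negatives --problem AnomalousDissipation`, 6 entries 2026-08-17:
14324, 0204, 13037, 2979, 2984, 2859): no stub is an instance — stub 1's energy bound is PER SOLUTION AT FIXED ν
(constant allowed to blow up like `ν⁻²`), not a ν-uniform ceiling over a family (the refuted 2979 / 2984 / 0204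
shape); stubs 2–3 are fixed-ν statements about one solution.

Shape (D-0027 §3.3, as `Cruxes/DeepSubBallisticFrames/Lines/birth.lean`): signatures `Sig.stub_<name> : Prop`,
registered stubs `theorem stub_<name> : Sig.stub_<name> := by sorry`, composition
`NoMeanLeakage_of : Sig.stub_absorbingBall → Sig.stub_tameDissipationMeans → Sig.stub_selectedDefectSublinear →
NoMeanLeakage` (sorry-free) and `NoMeanLeakage_proof`.

References: J. Leray, Acta Math. 63 (1934) [Leray1934]; M. Shinbrot, SIAM J. Math. Anal. 5 (1974)
[Shinbrot1974]; L. Caffarelli, R. Kohn, L. Nirenberg, CPAM 35 (1982) [CKN1982]; J. Duchon, R. Robert,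
Nonlinearity 13 (2000) [DuchonRobert2000]; J. C. Robinson, J. L. Rodrigo, W. Sadowski, *The three-dimensional
Navier–Stokes equations* (CUP 2016) §4.3 [RobinsonRodrigoSadowski2016]; H. Beirão da Veiga 1985
[BeiraoDaVeiga1985] = P. G. Lemarié-Rieusset, *The Navier–Stokes problem in the 21st century* (2016) Thm 18.5
[LemarieRieusset2016]; C. Foias, O. Manley, R. Rosa, R. Temam, *Navier–Stokes Equations and Turbulence* (CUP
2001) Ch. II, IV [FoiasManleyRosaTemam2001]; C. R. Doering, C. Foias, J. Fluid Mech. 467 (2002) §2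
[DoeringFoias2002]; T. Buckmaster, V. Vicol, Ann. Math. 189 (2019) [BuckmasterVicol2019AnnMath]; A. Cheskidov,
X. Luo, Invent. Math. 229 (2022) [CheskidovLuo2022].
-/

set_option linter.dupNamespace false

noncomputable section

namespace Summit.AnomalousDissipation.AnomalousDissipation.Cruxes.NoMeanLeakage.Birth

open MeasureTheory Set Filter Topology
open Literature.Analysis
open Summit.AnomalousDissipation.AnomalousDissipation.Theses.FrictionOrderLadder

/-- The flat three-torus (local notation). -/
local notation "𝕋³" => UnitAddTorus (Fin 3)
/-- Velocity values (local notation). -/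
local notation "E³" => EuclideanSpace ℝ (Fin 3)

/-! ### §0 Vocabulary of the seam (transparent `def`s over tree declarations) -/

/-- **Injected power** `t ↦ ∫_{T³} ⟪f(x), u(t,x)⟫ dx` of the steady force `f` into the flow `u` — the
integrand of the crux's left-hand side `longTimeAvgSup (t ↦ ∫⟪f, u t⟫)` (Doering–Foias 2002 §2). -/
def injection (f : 𝕋³ → E³) (u : ℝ → 𝕋³ → E³) (t : ℝ) : ℝ :=
  ∫ x, inner ℝ (f x) (u t x)

/-- **Viscous dissipation rate** `t ↦ ν‖∇u(t)‖₂²` (spectral `Torus.eGradNormSq`, `toReal`) — VERBATIM the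
integrand of `Literature.Analysis.FluidPDE.meanDissipation ν u`, so that
`meanDissipation ν u = longTimeAvgSup (dissipation ν u)` holds by `rfl`. -/
def dissipation (ν : ℝ) (u : ℝ → 𝕋³ → E³) (t : ℝ) : ℝ :=
  ν * (FunctionSpaces.Torus.eGradNormSq (u t)).toReal

/-- **Hyperviscosity selection** — VERBATIM the selection antecedent of the crux: `u` is, on every `(0, T)`,
a strong `L²((0,T) × T³)` limit of classical solutions `us k` of Lions' clean room at the SAME viscosity `ν`
(hyperviscosity `−μs k · Δ²` carried in the force slot as `f − μs k • fracLaplacian 2 (us k t)`), with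
`μs k > 0`, `μs → 0`, same datum `u₀`. -/
def IsHyperviscositySelected (ν : ℝ) (f u₀ : 𝕋³ → E³) (u : ℝ → 𝕋³ → E³) : Prop :=
  ∃ (μs : ℕ → ℝ) (us : ℕ → ℝ → 𝕋³ → E³) (ps : ℕ → ℝ → 𝕋³ → ℝ),
    (∀ k, 0 < μs k) ∧ Filter.Tendsto μs Filter.atTop (nhds 0) ∧
    (∀ k, FunctionSpaces.Torus.IsClassicalNSSolutionOn (Set.Ici 0) ν
        (fun t x => f x - μs k • FluidPDE.Torus.fracLaplacian (2 : ℝ) (us k t) x) (us k) (ps k) ∧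
      us k 0 = u₀) ∧
    ∀ T : ℝ, 0 < T → Filter.Tendsto
      (fun k => ∫ t in (0 : ℝ)..T, MeasureTheory.integral MeasureTheory.volume
        (fun x => ‖us k t x - u t x‖ ^ 2)) Filter.atTop (nhds 0)

/-! ### §1 Signatures of the registered stubs (by name; D-0027 §3.3 shape) -/

/-- STUB 1 — **ABSORBING BALL** (uniform-in-time energy bound of forced Leray–Hopf flows at FIXED `ν`;
known-type, TRUE, size M–L in Lean). VERBATIM the open support item `Correlation.AbsorbingBallLHTorus`
(stmt-AnomalousDissipation-0447): for `ν > 0`, smooth mean-zero steady `f`, any datum and any global Leray–Hopf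
`u`, `∃ C, ∀ t ≥ 0, E(u(t)) ≤ C`. Print: momentum conservation + spectral Poincaré on `u − ū` + energy
inequality from a.e. `s` ⇒ integral Gronwall from a.e. base points (FoiasManleyRosaTemam2001 Ch. II (7.9),
App. A (A.41)–(A.42); DoeringFoias2002 §2; Temam1979 Ch. III Rem. 3.2). `C` may depend on `ν` (NOT a ν-uniform
ceiling: the refuted 2979/2984/0204 range over families). Why it might fail: it should not; Lean cost = mean
propagation from the weak form, the a.e.-`s` Gronwall, `toReal` of the lintegral (finite by `memL2Sobolev`). -/
def Sig.stub_absorbingBall : Prop :=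
  ∀ (ν : ℝ) (f : 𝕋³ → E³) (u₀ : 𝕋³ → E³) (u : ℝ → 𝕋³ → E³), 0 < ν →
    FunctionSpaces.Torus.IsSmooth f → FunctionSpaces.Torus.HasZeroMean f →
    FluidPDE.Torus.IsGlobalLerayHopf ν (fun _ => f) u₀ u →
      ∃ C : ℝ, ∀ t : ℝ, 0 ≤ t → FunctionSpaces.Torus.kineticEnergy (u t) ≤ C

/-- STUB 2 — **TAME DISSIPATION MEANS** (the Doering–Foias upper bound at fixed `ν`, qualitative form;
known-type, TRUE, size M in Lean). For `ν > 0`, smooth `f`, a global Leray–Hopf `u` with `E(u(t)) ≤ C` for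
`t ≥ 0`, the Cesàro means `timeMean (dissipation ν u)` are bounded above at `+∞`: energy inequality from `0`
at `t = T` (`IsLerayHopfOn.energy_ineq_zero`), `E(u(T)) ≥ 0`, `|(f,u(t))| ≤ ‖f‖₂√(2C)`
(`intervalIntegral.norm_integral_le_of_norm_le_const`) and Bochner `∫₀ᵀ toReal G ≤ toReal ∫⁻₀ᵀ G` (finite by
`memL2Sobolev`; junk interval integrals are `0`, still bounded) give `T⁻¹∫₀ᵀ ν‖∇u‖² ≤ E(u₀)/T + ‖f‖₂√(2C)`
(DoeringFoias2002 §2 (2.5)–(2.7); FoiasManleyRosaTemam2001 (12.38)–(12.39); plan of stmt-AnomalousDissipation-0446).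
Why it might fail: it should not; Lean cost = measurability of `t ↦ eGradNormSq (u t)` and the
lintegral/Bochner conversion. -/
def Sig.stub_tameDissipationMeans : Prop :=
  ∀ (ν C : ℝ) (f u₀ : 𝕋³ → E³) (u : ℝ → 𝕋³ → E³), 0 < ν →
    FunctionSpaces.Torus.IsSmooth f →
    FluidPDE.Torus.IsGlobalLerayHopf ν (fun _ => f) u₀ u →
    (∀ t : ℝ, 0 ≤ t → FunctionSpaces.Torus.kineticEnergy (u t) ≤ C) →
      Filter.IsBoundedUnder (· ≤ ·) Filter.atTop (FluidPDE.timeMean (dissipation ν u))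

/-- STUB 3 — **SUBLINEAR DEFECT OF THE SELECTED SOLUTION** (THE HEART, XL: zero time-density of the
Leray–Hopf energy defect of hyperviscosity-selected solutions at fixed `ν`). Under the crux's hypotheses
VERBATIM there is `D : ℝ → ℝ`, `D(T)/T → 0`, with the REVERSE energy inequality up to `D`:
`E(u₀) + ∫₀ᵀ(f,u) ≤ E(u(T)) + ∫₀ᵀ ν‖∇u‖₂² + D(T)` for every `T > 0`. A genuine strengthening of the crux
(pointwise `o(T)` defect vs. a comparison of `limsup`s). Mechanisms: eventual / locally-uniform Shinbrot–Lions
integrability of the selected solution (exact balance on such windows by the PROVED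
`Literature.Analysis.FluidPDE.lions_energy_equality_Ioc'`; RobinsonRodrigoSadowski2016 Thm 4.6), i.e. zero
time-density of its Duchon–Robert measure (`IsLerayHopfOn.exists_dissipationMeasure_univ_le`); μ-uniform higher
bounds on the clean-room family on time sets of density `1 − o(1)` (no loss of dissipation as `μ_k → 0` there);
Leray's eventual regularity made quantitative for steady forcing (Leray1934 §34, CKN1982). Why it might fail: a
selected Leray–Hopf solution whose energy defects recur with positive time density at fixed `ν` (leakage is
real in weaker classes: BuckmasterVicol2019AnnMath, CheskidovLuo2022), or the extra pointwise strength.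
Sources: Leray1934, Shinbrot1974, CKN1982, DuchonRobert2000, RobinsonRodrigoSadowski2016 §4.3,
BeiraoDaVeiga1985 = LemarieRieusset2016 Thm 18.5. -/
def Sig.stub_selectedDefectSublinear : Prop :=
  ∀ (ν : ℝ) (f u₀ : 𝕋³ → E³) (u : ℝ → 𝕋³ → E³), 0 < ν →
    FunctionSpaces.Torus.IsSmooth f → FunctionSpaces.Torus.IsDivFree f →
    FunctionSpaces.Torus.HasZeroMean f →
    FunctionSpaces.Torus.IsSmooth u₀ → FunctionSpaces.Torus.IsDivFree u₀ →
    FunctionSpaces.Torus.HasZeroMean u₀ →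
    FluidPDE.Torus.IsGlobalLerayHopf ν (fun _ => f) u₀ u →
    IsHyperviscositySelected ν f u₀ u →
      ∃ D : ℝ → ℝ, Filter.Tendsto (fun T => D T / T) Filter.atTop (nhds 0) ∧
        ∀ T : ℝ, 0 < T →
          FunctionSpaces.Torus.kineticEnergy u₀ + ∫ t in (0 : ℝ)..T, injection f u t ≤
            FunctionSpaces.Torus.kineticEnergy (u T) + (∫ t in (0 : ℝ)..T, dissipation ν u t) + D T

/-! ### §2 Proved glue: Cesàro–`limsup` domination (no `sorry`) -/

/-- **Cesàro–`limsup` domination** (real analysis in the tree's long-time-average vocabulary; PROVED). If the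
cumulative integrals satisfy `∫₀ᵀ g ≤ ∫₀ᵀ h + D(T)` for all large `T`, the error is sublinear (`D(T)/T → 0`),
and the Cesàro means `timeMean h` are eventually nonnegative and bounded above at `+∞`, then
`longTimeAvgSup g ≤ longTimeAvgSup h` — with no hypothesis on the means of `g`: if they are cobounded the left
`limsup` is genuine and `m_g ≤ m_h + D/T < limsup m_h + ε` eventually for every `ε > 0`; otherwise the left
`limsup` is the `Real.sInf` junk value `0` of a set unbounded below, and `0 ≤ limsup m_h`. [folklore;
DoeringFoias2002 §2 for the averages] -/
theorem cesaroDomination (g h D : ℝ → ℝ) (hD : Tendsto (fun T => D T / T) atTop (𝓝 0))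
    (hev : ∀ᶠ T in atTop, (∫ t in (0 : ℝ)..T, g t) ≤ (∫ t in (0 : ℝ)..T, h t) + D T)
    (hh0 : ∀ᶠ T in atTop, 0 ≤ FluidPDE.timeMean h T)
    (hh : IsBoundedUnder (· ≤ ·) atTop (FluidPDE.timeMean h)) :
    FluidPDE.longTimeAvgSup g ≤ FluidPDE.longTimeAvgSup h := by
  -- Cesàro means: `m_g T ≤ m_h T + D T / T` for large `T`.
  have hev' : ∀ᶠ T in atTop, FluidPDE.timeMean g T ≤ FluidPDE.timeMean h T + D T / T := by
    filter_upwards [hev, eventually_gt_atTop (0 : ℝ)] with T hT hT0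
    have hinv : (0 : ℝ) ≤ T⁻¹ := inv_nonneg.2 hT0.le
    have hmul := mul_le_mul_of_nonneg_left hT hinv
    simpa only [FluidPDE.timeMean, mul_add, div_eq_inv_mul] using hmul
  unfold FluidPDE.longTimeAvgSup
  by_cases hcob : IsCoboundedUnder (· ≤ ·) atTop (FluidPDE.timeMean g)
  · -- genuine `limsup` on the left: `m_g ≤ m_h + D/T < limsup m_h + ε` eventually, every `ε > 0`
    refine le_of_forall_pos_le_add fun ε hε => ?_
    have h1 : ∀ᶠ T in atTop, FluidPDE.timeMean h T < limsup (FluidPDE.timeMean h) atTop + ε / 2 :=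
      eventually_lt_of_limsup_lt (by linarith) hh
    have h2 : ∀ᶠ T in atTop, D T / T < ε / 2 :=
      hD.eventually (Iio_mem_nhds (by positivity))
    refine limsup_le_of_le hcob ?_
    filter_upwards [hev', h1, h2] with T hT h1T h2T
    linarith
  · -- junk `limsup` on the left (`m_g → -∞`: `Real.sInf` of a set unbounded below is `0`),
    -- while `0 ≤ limsup m_h` from `m_h ≥ 0` eventually and boundedness above
    have hS : ¬ BddBelow {a | ∀ᶠ T in atTop, FluidPDE.timeMean g T ≤ a} := by
      rintro ⟨b, hb⟩
      exact hcob ⟨b, fun a ha => hb (Filter.eventually_map.1 ha)⟩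
    rw [Filter.limsup_eq, Real.sInf_of_not_bddBelow hS]
    exact le_limsup_of_frequently_le hh0.frequently hh

/-! ### §3 Registered stubs (the only `sorry`s of the file) -/

/-- Registered stub 1 — absorbing ball (theorem-grade; claimable now; = stmt-AnomalousDissipation-0447). -/
theorem stub_absorbingBall : Sig.stub_absorbingBall := by
  sorry

/-- Registered stub 2 — tame dissipation means (theorem-grade; claimable now). -/
theorem stub_tameDissipationMeans : Sig.stub_tameDissipationMeans := by
  sorry

/-- Registered stub 3 — sublinear defect of the selected solution (the heart; hardest). -/
theorem stub_selectedDefectSublinear : Sig.stub_selectedDefectSublinear := by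
  sorry

/-! ### §4 Composition (kernel-checked; no `sorry` outside the three stubs) -/

/-- **The skeleton closes the crux BY NAME**: `Sig.stub_absorbingBall → Sig.stub_tameDissipationMeans →
Sig.stub_selectedDefectSublinear → FrictionOrderLadder.NoMeanLeakage`. Absorbing ball ⇒ `M`; stub 2 ⇒ the
dissipation means are bounded above; the heart ⇒ the sublinear defect `D`; the corrected error
`D' = D + E(u(·)) − E(u₀)` is sublinear (squeeze) and gives `∫₀ᵀ(f,u) ≤ ∫₀ᵀ ν‖∇u‖² + D'(T)` for `T > 0`; the
dissipation means are `≥ 0`; `cesaroDomination` is then literally the crux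
(`meanDissipation ν u = longTimeAvgSup (dissipation ν u)` by `rfl`). -/
theorem NoMeanLeakage_of :
    Sig.stub_absorbingBall → Sig.stub_tameDissipationMeans → Sig.stub_selectedDefectSublinear →
      NoMeanLeakage := by
  intro h₀ h₁ h₂ ν f u₀ u hν hf hdf hmf hu₀ hdu₀ hmu₀ hLH hsel
  -- Stub 1: the absorbing ball of the Leray–Hopf flow (no selection used).
  obtain ⟨M, hM⟩ := h₀ ν f u₀ u hν hf hmf hLH
  -- Stub 2: the Cesàro means of the dissipation are bounded above.
  have hdis : IsBoundedUnder (· ≤ ·) atTop (FluidPDE.timeMean (dissipation ν u)) :=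
    h₁ ν M f u₀ u hν hf hLH hM
  -- Stub 3: the sublinear defect of the selected solution.
  obtain ⟨D, hD, hbud⟩ := h₂ ν f u₀ u hν hf hdf hmf hu₀ hdu₀ hmu₀ hLH hsel
  -- The corrected error `D' T = D T + E(u T) - E(u₀)` is sublinear.
  have hE₀ : Tendsto (fun T : ℝ => FunctionSpaces.Torus.kineticEnergy u₀ / T) atTop (𝓝 0) :=
    tendsto_const_nhds.div_atTop tendsto_id
  have hMT : Tendsto (fun T : ℝ => M / T) atTop (𝓝 0) :=
    tendsto_const_nhds.div_atTop tendsto_id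
  have hET : Tendsto (fun T : ℝ => FunctionSpaces.Torus.kineticEnergy (u T) / T) atTop (𝓝 0) := by
    refine squeeze_zero' ?_ ?_ hMT
    · filter_upwards [eventually_gt_atTop (0 : ℝ)] with T hT
      exact div_nonneg (FunctionSpaces.Torus.kineticEnergy_nonneg _) hT.le
    · filter_upwards [eventually_gt_atTop (0 : ℝ)] with T hT
      exact div_le_div_of_nonneg_right (hM T hT.le) hT.le
  have hD' : Tendsto (fun T : ℝ =>
      (D T + FunctionSpaces.Torus.kineticEnergy (u T) - FunctionSpaces.Torus.kineticEnergy u₀) / T)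
      atTop (𝓝 0) := by
    have hsum : Tendsto (fun T : ℝ => D T / T + FunctionSpaces.Torus.kineticEnergy (u T) / T -
        FunctionSpaces.Torus.kineticEnergy u₀ / T) atTop (𝓝 0) := by
      simpa using (hD.add hET).sub hE₀
    refine hsum.congr' (Eventually.of_forall fun T => ?_)
    simp only [add_div, sub_div]
  -- The budget, rewritten as domination of cumulative injection by cumulative dissipation up to `D'`.
  have hev : ∀ᶠ T in atTop, (∫ t in (0 : ℝ)..T, injection f u t) ≤
      (∫ t in (0 : ℝ)..T, dissipation ν u t) +
        (D T + FunctionSpaces.Torus.kineticEnergy (u T) - FunctionSpaces.Torus.kineticEnergy u₀) := by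
    filter_upwards [eventually_gt_atTop (0 : ℝ)] with T hT
    have hb := hbud T hT
    linarith
  -- The Cesàro means of the dissipation are nonnegative (no integrability needed).
  have hh0 : ∀ᶠ T in atTop, 0 ≤ FluidPDE.timeMean (dissipation ν u) T := by
    filter_upwards [eventually_ge_atTop (0 : ℝ)] with T hT
    unfold FluidPDE.timeMean
    refine mul_nonneg (inv_nonneg.2 hT) (intervalIntegral.integral_nonneg hT fun t _ => ?_)
    exact mul_nonneg hν.le ENNReal.toReal_nonneg
  -- Cesàro domination (proved above); the conclusion is the crux's inequality by `rfl`.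
  exact cesaroDomination (injection f u) (dissipation ν u)
    (fun T => D T + FunctionSpaces.Torus.kineticEnergy (u T) - FunctionSpaces.Torus.kineticEnergy u₀)
    hD' hev hh0 hdis

/-- The skeleton in its final shape (D-0027 §3.3): the crux BY NAME from the three registered stubs; it
becomes the crux proof when the last `stub_*` is discharged (until then it depends on `sorryAx` through the
stubs only — no `sorry` of its own). -/
theorem NoMeanLeakage_proof : NoMeanLeakage :=
  NoMeanLeakage_of stub_absorbingBall stub_tameDissipationMeans stub_selectedDefectSublinear

end Summit.AnomalousDissipation.AnomalousDissipation.Cruxes.NoMeanLeakage.Birth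

end
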